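import Summits.BirchSwinnertonDyer.BirchSwinnertonDyer.Theorems.SignedLowerHalvesSmallImageLowerHalfBothSignsRttD2SeqSemilocVanishing
import Summits.BirchSwinnertonDyer.BirchSwinnertonDyer.Theorems.SignedLowerHalvesSmallImageLowerHalfBothSignsRttCharRoadE2DualOStructure
import Literature.NumberTheory.EllipticCurves.BigRepModuleShapiroDualityProofs
import HarnessLib

/-!
# Route `SignedLowerHalves`, crux L `SmallImageLowerHalfBothSigns` (stmt-BirchSwinnertonDyer-23599), line `rtt_w3` v30 — stub S3β″ (`stub_junctionPT_ns`, row J4′,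
# Poitou–Tate half), brick N2d (β): THE MAP `Φ : Π_{w∈S₀} 𝐇¹_{Iw,w} → Y″ = (Sel_{str,v} ⧸ Sel_{str at Σ})^∨`, `Φ h [s] = Σ_{w∈S₀} ⟨h_w, s⟩_{w,∞}`, AND ITS `Λ`-LINEARITY

WIDTH seat `bsd-line-slh-p3-w3` g26 under LEAD `cruxlead-stmt-BirchSwinnertonDyer-23599` g14 (cell `bsd-ssimc`); helper `--supports stmt-BirchSwinnertonDyer-23599`
(design memo `Lines/rtt_w3-DESIGN-S3beta-w3-g25.md`, rev 4 §6 RECIPE N2d). DEFINITIONS WITH BODIES (`phiSel`, `phiStrictAt`, `phiLocImageFun`, `phiLocImage`, `phiLinearMap`) + THEOREMS; no named fact,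
no instance, no `sorry`. HONEST FRAMING: the map `Φ` of T5's λ-assembly (`lambdaInvariant_le_add_of_ker_subset_range_semilocMapPi`, p812244) is CONSTRUCTED and proved `Λ`-linear; its
kernel property «`Φ h = 0` ⇒ the levelwise orthogonality (i) of T4» is the next brick (γ); nothing about S3β″, S3α′, crux L or BSD is proved; all remain OPEN and are proved for NO curve.

WHAT. For honda's orientation (`L w : SemilocIwasawaCohomologyDataO S κ γ⁻¹ θ′ P w 1`, `γ` a topological generator) and the `v`-strict saturated signed Selmer group `Sel_{str,v}`
(`strictAt`, g21/g22) with lambda-p1's `locImageQuot = Sel_{str,v} ⧸ Sel_{str at Σ}` (p810118):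
* §1 `phiSel h : Sel^{ε,S₀}_{sat}(K_∞) →+ ℚ/ℤ`, `s ↦ Σ_{w∈S₀} ⟨h_w, s⟩_{w,∞}` (N2c `pairInf`); `phiStrictAt` (restriction to `Sel_{str,v}`); ★★ `phiLocImage` — the DESCENT modulo
  `Sel_{str at Σ}` for `S₀ ⊆ Σ` (well defined by N2d (α) `pairInf_eq_zero_of_mem_strictSelmer`), `phiLocImage_mk`.
* §2 LAWS: `phiLocImage_X_smul` (`Φ(T·h)[s] = Φ h[conj_γ s] − Φ h[s]`, from `pairInf_X_smul` + `inv_inv`), `phiLocImage_C_smul` (`Φ(C c·h)[s] = (c mod p^k)·Φ h[s]` for `p^k [s] = 0`, from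
  `pairInf_C_smul` + `scalarH1_padicInt_apply_of_pow_smul_eq_zero` + `zpT_of_le`), hence ★★★ `phiLocImage_smul_eq_smulFun` — `Φ` is `Λ`-LINEAR for the product of the `moduleIwasawa` structures and
  lambda-p1's forced `locImageDualModule` (the tree's forcing lemma `IwasawaDual.IsLocNil.map_smul_eq_smulFun`) — packaged as `phiLinearMap`.
* §3 `phiLocImage_mk_eq_sum_semilocPairNKQ`: on the class of `res_n(torsToH1 ℓ)` the value is `Σ_w ⟨proj_{n,k} h_w, semilocDual ℓ⟩_{w,n,k} / p^k` (the form consumed by T4).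
References: [GreenbergLNM1716] §1 (after Conj. 1.3); [Rubin2000] Thm. 1.7.3, App. B.3; [Kobayashi2003] Thm. 7.3 i); [PerrinRiou1994Invent] §3.6.1; [Washington1997] §13.2.
-/

set_option autoImplicit false
set_option linter.dupNamespace false -- D-0017: single-problem summit, the namespace repeats the problem name by design
noncomputable section

open scoped Classical
open CategoryTheory Function NumberField IsDedekindDomain Field

namespace Summit.BirchSwinnertonDyer.BirchSwinnertonDyer.Theorems.SmallImageRttD2Seq

open Literature.NumberTheory.GaloisRepresentations Literature.NumberTheory.GaloisCohomology Literature.NumberTheory.EllipticCurves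
  Literature.NumberTheory.EllipticCurves.IwasawaDual
  Literature.NumberTheory.ComplexMultiplication.EllipticUnits Literature.NumberTheory.ComplexMultiplication.EllipticUnits.JohnsonLeungKings2011
  Literature.NumberTheory.GaloisRepresentations.DiscreteGaloisModule Literature.NumberTheory.GaloisCohomology.PoitouTateFinite
  Literature.AnabelianGeometry.AbsoluteAnabelian.Prop121vii
  Summit.BirchSwinnertonDyer.BirchSwinnertonDyer.Theorems.SmallImageRttD2J1 Summit.BirchSwinnertonDyer.BirchSwinnertonDyer.Theorems.SmallImageCharSignedSelmer

section Phi

variable {K : Type} [Field K] [NumberField K] {p : ℕ} [Fact p.Prime] (S : Set (PadicAlgCl p)) [FiniteDimensional ℚ_[p] (padicCoeffField S)] (κ : ZpExtension K p)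
  (γ : absoluteGaloisGroup K) (θ' : absoluteGaloisGroup K →ₜ* (padicCoeffIntegers S)ˣ) (P : Set (HeightOneSpectrum (𝓞 K)))
  (M : Type) [AddCommGroup M] [TopologicalSpace M] [DiscreteTopology M] [DistribMulAction (absoluteGaloisGroup K) M] [Module (padicCoeffIntegers S) M]
  (hstabK : ∀ m : M, IsOpen (MulAction.stabilizer (absoluteGaloisGroup K) m : Set (absoluteGaloisGroup K)))
  (PG : ∀ k : ℕ, ContPairing (coeffRepK S θ' P k).toTopRep (torsRep M hstabK p k).toTopRep (mu K (p ^ k)).toTopRep)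
  (hPred : ∀ (k : ℕ) (x : ↥(Representation.invariants ((muTwistO S θ' (k + 1)).toRepresentation.comp (ramificationSubgroup K P).subtype))) (m : ↥(torsionPow M p k)),
    (PG (k + 1)).toLin x (AddSubgroup.inclusion (torsionPow_mono (M := M) (p := p) (Nat.le_succ k)) m) =
      muInclusion K (pow_dvd_pow p (Nat.le_succ k)) ((PG k).toLin (coeffMapO S P θ' (oMuRed S k) (oMuRed_muTwistO S θ' k) x) m))
  (hM : ∀ m : M, ∃ k : ℕ, p ^ k • m = 0)
  (V : WeierstrassCurve K) (j : V.geomPrimaryTorsion p →+ M) (S₀ : Set (HeightOneSpectrum (𝓞 K))) (hS₀ : S₀.Finite) (ε : ℤˣ)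
  (v : HeightOneSpectrum (𝓞 K)) [DistribMulAction (absoluteGaloisGroup (v.adicCompletion K)) M]
  (hres : ∀ (σ : absoluteGaloisGroup (v.adicCompletion K)) (m : M), σ • m = resGalOfEmb (closureEmb (K := K) (v.adicCompletion K)) σ • m)
  (hv : (p : 𝓞 K) ∈ v.asIdeal)
  (L : ∀ w : HeightOneSpectrum (𝓞 K), SemilocIwasawaCohomologyDataO S κ γ⁻¹ θ' P w 1)

/-! ## §1. `Φ` on `Sel_{sat}(K_∞)`, on `Sel_{str,v}`, and its descent modulo `Sel_{str at Σ}` -/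

/-- **`Φ` on the saturated signed Selmer group**: `h ↦ (s ↦ Σ_{w∈S₀} ⟨h_w, s⟩_{w,∞})` (N2c `pairInf`, summed over the finite `S₀`). [cite: Kobayashi2003, Thm. 7.3 i)] [cite: Rubin2000, Thm. 1.7.3] -/
def phiSel : (∀ w : S₀, (L w).H) →+ (signedTransportSelmerInftySat κ M (padicCoeffIntegers S) V j S₀ ε →+ AddCircle (1 : ℚ)) where
  toFun h := haveI := hS₀.fintype
    ∑ w : S₀, ((L w).pairInf M hstabK PG hPred hM (h w)).comp (signedTransportSelmerInftySat κ M (padicCoeffIntegers S) V j S₀ ε).subtype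
  map_zero' := by
    haveI := hS₀.fintype
    exact Finset.sum_eq_zero fun w _ ↦ by rw [Pi.zero_apply, map_zero, AddMonoidHom.zero_comp]
  map_add' := fun h h' ↦ by
    haveI := hS₀.fintype
    rw [← Finset.sum_add_distrib]
    exact Finset.sum_congr rfl fun w _ ↦ by rw [Pi.add_apply, map_add, AddMonoidHom.add_comp]

/-- Values of `phiSel`. [folklore] -/
theorem phiSel_apply (h : ∀ w : S₀, (L w).H) (s : signedTransportSelmerInftySat κ M (padicCoeffIntegers S) V j S₀ ε) :
    phiSel S κ γ θ' P M hstabK PG hPred hM V j S₀ hS₀ ε L h s =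
      haveI := hS₀.fintype
      ∑ w : S₀, (L w).pairInf M hstabK PG hPred hM (h w) (s : subgroupH1 κ.kerSubgroup M) := by
  change (haveI := hS₀.fintype
    ∑ w : S₀, ((L w).pairInf M hstabK PG hPred hM (h w)).comp (signedTransportSelmerInftySat κ M (padicCoeffIntegers S) V j S₀ ε).subtype) s = _
  rw [AddMonoidHom.finsetSum_apply]
  rfl

/-- **`Φ` on `Sel_{str,v}`** (restriction along `Sel_{str,v} ≤ Sel_{sat}`). [cite: Kobayashi2003, Thm. 7.3 i)] -/
def phiStrictAt : (∀ w : S₀, (L w).H) →+ (strictAt κ M (padicCoeffIntegers S) V j S₀ ε v hres hv →+ AddCircle (1 : ℚ)) :=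
  (AddMonoidHom.compHom' (strictAt κ M (padicCoeffIntegers S) V j S₀ ε v hres hv).subtype).comp (phiSel S κ γ θ' P M hstabK PG hPred hM V j S₀ hS₀ ε L)

/-- Values of `phiStrictAt`. [folklore] -/
theorem phiStrictAt_apply (h : ∀ w : S₀, (L w).H) (s : strictAt κ M (padicCoeffIntegers S) V j S₀ ε v hres hv) :
    phiStrictAt S κ γ θ' P M hstabK PG hPred hM V j S₀ hS₀ ε v hres hv L h s =
      haveI := hS₀.fintype
      ∑ w : S₀, (L w).pairInf M hstabK PG hPred hM (h w) ((s : signedTransportSelmerInftySat κ M (padicCoeffIntegers S) V j S₀ ε) : subgroupH1 κ.kerSubgroup M) :=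
  phiSel_apply S κ γ θ' P M hstabK PG hPred hM V j S₀ hS₀ ε L h s

variable (S₁ : Set (HeightOneSpectrum (𝓞 K))) (hS₀S₁ : S₀ ⊆ S₁)

/-- `Φ h` on `Sel_{str,v} ⧸ Sel_{str at Σ}` as a bare additive map (the descent of `phiStrictAt h`; well defined by N2d (α) `pairInf_eq_zero_of_mem_strictSelmer`, `S₀ ⊆ Σ`).
[cite: Rubin2000, Thm. 1.7.3] -/
def phiLocImageFun (h : ∀ w : S₀, (L w).H) : locImageQuot κ M (padicCoeffIntegers S) V j S₀ ε v hres hv S₁ →+ AddCircle (1 : ℚ) :=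
  QuotientAddGroup.lift (strictInStrictAt κ M (padicCoeffIntegers S) V j S₀ ε v hres hv S₁) (phiStrictAt S κ γ θ' P M hstabK PG hPred hM V j S₀ hS₀ ε v hres hv L h)
    fun s hs ↦ by
      haveI := hS₀.fintype
      have hs' : (s : signedTransportSelmerInftySat κ M (padicCoeffIntegers S) V j S₀ ε) ∈ strictSelmer κ M (padicCoeffIntegers S) V j S₀ ε S₁ :=
        AddSubgroup.mem_addSubgroupOf.mp hs
      rw [AddMonoidHom.mem_ker, phiStrictAt_apply]
      exact Finset.sum_eq_zero fun w _ ↦ (L w).pairInf_eq_zero_of_mem_strictSelmer M hstabK PG hPred hM V j S₀ ε (hS₀S₁ w.2) (h w) hs'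

/-- Values of `phiLocImageFun` on classes. [folklore] -/
theorem phiLocImageFun_mk (h : ∀ w : S₀, (L w).H) (s : strictAt κ M (padicCoeffIntegers S) V j S₀ ε v hres hv) :
    phiLocImageFun S κ γ θ' P M hstabK PG hPred hM V j S₀ hS₀ ε v hres hv L S₁ hS₀S₁ h (QuotientAddGroup.mk s) =
      haveI := hS₀.fintype
      ∑ w : S₀, (L w).pairInf M hstabK PG hPred hM (h w) ((s : signedTransportSelmerInftySat κ M (padicCoeffIntegers S) V j S₀ ε) : subgroupH1 κ.kerSubgroup M) := by
  rw [phiLocImageFun, QuotientAddGroup.lift_mk, phiStrictAt_apply]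

/-- ★★ **`Φ : Π_{w∈S₀} 𝐇¹_{Iw,w} →+ Hom(Sel_{str,v} ⧸ Sel_{str at Σ}, ℚ/ℤ)`, `Φ h [s] = Σ_{w∈S₀} ⟨h_w, s⟩_{w,∞}`** (`S₀ ⊆ Σ`) — well defined because every `⟨h_w, ·⟩_{w,∞}` kills `Sel_{str at Σ}`
(N2d (α) `pairInf_eq_zero_of_mem_strictSelmer`). This is the semilocal side `Hloc → (Sel_{str,v} ⧸ Sel_str)^∨` of the compact Poitou–Tate sequence behind S3β″. [cite: Rubin2000, Thm. 1.7.3, App. B.3]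
[cite: Kobayashi2003, Thm. 7.3 i)] -/
def phiLocImage : (∀ w : S₀, (L w).H) →+ (locImageQuot κ M (padicCoeffIntegers S) V j S₀ ε v hres hv S₁ →+ AddCircle (1 : ℚ)) where
  toFun := phiLocImageFun S κ γ θ' P M hstabK PG hPred hM V j S₀ hS₀ ε v hres hv L S₁ hS₀S₁
  map_zero' := by
    haveI := hS₀.fintype
    refine AddMonoidHom.ext fun q ↦ QuotientAddGroup.induction_on q fun s ↦ ?_
    rw [phiLocImageFun_mk, AddMonoidHom.zero_apply]
    exact Finset.sum_eq_zero fun w _ ↦ by rw [Pi.zero_apply, map_zero, AddMonoidHom.zero_apply]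
  map_add' := fun h h' ↦ by
    haveI := hS₀.fintype
    refine AddMonoidHom.ext fun q ↦ QuotientAddGroup.induction_on q fun s ↦ ?_
    rw [phiLocImageFun_mk, AddMonoidHom.add_apply, phiLocImageFun_mk, phiLocImageFun_mk, ← Finset.sum_add_distrib]
    exact Finset.sum_congr rfl fun w _ ↦ by rw [Pi.add_apply, map_add, AddMonoidHom.add_apply]

/-- ★ Values of `Φ` on classes: `Φ h [s] = Σ_{w∈S₀} ⟨h_w, s⟩_{w,∞}`. [cite: Rubin2000, Thm. 1.7.3] -/
theorem phiLocImage_mk (h : ∀ w : S₀, (L w).H) (s : strictAt κ M (padicCoeffIntegers S) V j S₀ ε v hres hv) :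
    phiLocImage S κ γ θ' P M hstabK PG hPred hM V j S₀ hS₀ ε v hres hv L S₁ hS₀S₁ h (QuotientAddGroup.mk s) =
      haveI := hS₀.fintype
      ∑ w : S₀, (L w).pairInf M hstabK PG hPred hM (h w) ((s : signedTransportSelmerInftySat κ M (padicCoeffIntegers S) V j S₀ ε) : subgroupH1 κ.kerSubgroup M) :=
  phiLocImageFun_mk S κ γ θ' P M hstabK PG hPred hM V j S₀ hS₀ ε v hres hv L S₁ hS₀S₁ h s

/-! ## §2. The two laws and `Λ`-linearity -/

/-- **`Φ(T·h)[s] = Φ h[conj_γ s] − Φ h[s]`** (N2c `pairInf_X_smul` for honda's orientation `γ⁻¹`: `conj_{(γ⁻¹)⁻¹} = conj_γ`). [cite: Kato2004Asterisque, §17.13] [cite: GreenbergLNM1716, §1 (after Conj. 1.3)] -/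
theorem phiLocImage_X_smul (hns : AcSigned.IsNonsplitIn κ v) (h : ∀ w : S₀, (L w).H) (q : locImageQuot κ M (padicCoeffIntegers S) V j S₀ ε v hres hv S₁) :
    phiLocImage S κ γ θ' P M hstabK PG hPred hM V j S₀ hS₀ ε v hres hv L S₁ hS₀S₁
        (letI : ∀ w : HeightOneSpectrum (𝓞 K), Module (IwasawaAlgebra p) (L w).H := fun w ↦ (L w).moduleIwasawa
         (PowerSeries.X : IwasawaAlgebra p) • h) q =
      phiLocImage S κ γ θ' P M hstabK PG hPred hM V j S₀ hS₀ ε v hres hv L S₁ hS₀S₁ h ((conjLocImage κ M (padicCoeffIntegers S) V j S₀ ε v hres hv S₁ hns γ - 1) q) := by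
  letI : ∀ w : HeightOneSpectrum (𝓞 K), Module (IwasawaAlgebra p) (L w).H := fun w ↦ (L w).moduleIwasawa
  haveI := hS₀.fintype
  obtain ⟨s, rfl⟩ := QuotientAddGroup.mk_surjective q
  rw [IwasawaDual.End_sub_apply, AddMonoid.End.one_apply, conjLocImage_mk, map_sub, phiLocImage_mk, phiLocImage_mk, phiLocImage_mk, ← Finset.sum_sub_distrib]
  refine Finset.sum_congr rfl fun w _ ↦ ?_
  rw [Pi.smul_apply, SemilocIwasawaCohomologyDataO.moduleIwasawa_smul, show iwasawaToIwasawaO S (PowerSeries.X : IwasawaAlgebra p) = PowerSeries.X from PowerSeries.map_X _,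
    (L w).pairInf_X_smul M hstabK PG hPred hM, inv_inv, coe_conjStrictAtEnd_apply, coe_conjSignedSat_apply]

include hM in
/-- **`Φ(C c·h)[s] = (c mod p^k)·Φ h[s]` whenever `p^k [s] = 0`** (N2c `pairInf_C_smul` for the constant `ι₀ c ∈ 𝒪`, the scalar `ι₀ c` acting on the `p^{k′}`-torsion class `s` as `c mod p^{k′}`,
`scalarH1_padicInt_apply_of_pow_smul_eq_zero`, and `c mod p^{k+k′} ≡ c mod p^k` on the `p^k`-torsion value, `zpT_of_le`). [cite: Lang1990, Ch. 5 §1] [cite: GreenbergLNM1716, §1 (after Conj. 1.3)] -/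
theorem phiLocImage_C_smul [SMulCommClass (absoluteGaloisGroup K) (padicCoeffIntegers S) M]
    (hPsc : ∀ (k : ℕ) (a : padicCoeffIntegers S) (x : ↥(Representation.invariants ((muTwistO S θ' k).toRepresentation.comp (ramificationSubgroup K P).subtype)))
      (m : ↥(torsionPow M p k)), (PG k).toLin (coeffMapO S P θ' (oMuScalar S (p ^ k) a) (oMuScalar_muTwistO S θ' k a) x) m = (PG k).toLin x (a • m))
    (c : ℤ_[p]) (h : ∀ w : S₀, (L w).H) (q : locImageQuot κ M (padicCoeffIntegers S) V j S₀ ε v hres hv S₁) (k : ℕ) (hq : p ^ k • q = 0) :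
    phiLocImage S κ γ θ' P M hstabK PG hPred hM V j S₀ hS₀ ε v hres hv L S₁ hS₀S₁
        (letI : ∀ w : HeightOneSpectrum (𝓞 K), Module (IwasawaAlgebra p) (L w).H := fun w ↦ (L w).moduleIwasawa
         (PowerSeries.C c : IwasawaAlgebra p) • h) q =
      (PadicInt.toZModPow k c).val • phiLocImage S κ γ θ' P M hstabK PG hPred hM V j S₀ hS₀ ε v hres hv L S₁ hS₀S₁ h q := by
  letI : ∀ w : HeightOneSpectrum (𝓞 K), Module (IwasawaAlgebra p) (L w).H := fun w ↦ (L w).moduleIwasawa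
  haveI := hS₀.fintype
  obtain ⟨s, rfl⟩ := QuotientAddGroup.mk_surjective q
  -- the class `s` is `p^{k'}`-torsion
  obtain ⟨k', hk'⟩ := GreenbergSelmer.exists_pow_smul_subgroupH1_eq_zero κ M hM
    ((s : signedTransportSelmerInftySat κ M (padicCoeffIntegers S) V j S₀ ε) : subgroupH1 κ.kerSubgroup M)
  have hks : p ^ (k + k') • ((s : signedTransportSelmerInftySat κ M (padicCoeffIntegers S) V j S₀ ε) : subgroupH1 κ.kerSubgroup M) = 0 := by
    rw [pow_add, mul_smul, hk', smul_zero]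
  have hval : p ^ k • phiLocImage S κ γ θ' P M hstabK PG hPred hM V j S₀ hS₀ ε v hres hv L S₁ hS₀S₁ h (QuotientAddGroup.mk s) = 0 := by
    rw [← map_nsmul, hq, map_zero]
  rw [← zpT_def, ← zpT_of_le (Nat.le_add_right k k') hval c, zpT_def, phiLocImage_mk, phiLocImage_mk, Finset.smul_sum]
  refine Finset.sum_congr rfl fun w _ ↦ ?_
  rw [Pi.smul_apply, SemilocIwasawaCohomologyDataO.moduleIwasawa_smul,
    show iwasawaToIwasawaO S (PowerSeries.C c : IwasawaAlgebra p) = PowerSeries.C (padicIntToCoeffIntegers S c) from PowerSeries.map_C _ _,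
    (L w).pairInf_C_smul M hstabK PG hPred hM hPsc, scalarH1_padicInt_apply_of_pow_smul_eq_zero _ M (padicIntToCoeffIntegers S) c hks, map_nsmul]

include hM in
/-- ★★★ **`Φ` IS `Λ`-LINEAR**: `Φ(f·h) = f ⋆ Φ h` for the product of the scalar-restricted structures `moduleIwasawa` on the `𝐇¹_{Iw,w}` and the canonical finite-sum action
`⋆ = IsLocNil.smulFun` of `ψ = conj_γ − 1` on `(Sel_{str,v} ⧸ Sel_str)^∨` (which IS lambda-p1's forced `locImageDualModule`, `IwasawaDual.IsLocNil.module_smul_eq`): the tree's forcing lemma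
`IwasawaDual.IsLocNil.map_smul_eq_smulFun` with the two laws of §2. [cite: GreenbergLNM1716, §1 (after Conj. 1.3)] [cite: Lang1990, Ch. 5 §1] [cite: Rubin2000, Thm. 1.7.3, App. B.3] -/
theorem phiLocImage_smul_eq_smulFun [SMulCommClass (absoluteGaloisGroup K) (padicCoeffIntegers S) M]
    (hPsc : ∀ (k : ℕ) (a : padicCoeffIntegers S) (x : ↥(Representation.invariants ((muTwistO S θ' k).toRepresentation.comp (ramificationSubgroup K P).subtype)))
      (m : ↥(torsionPow M p k)), (PG k).toLin (coeffMapO S P θ' (oMuScalar S (p ^ k) a) (oMuScalar_muTwistO S θ' k a) x) m = (PG k).toLin x (a • m))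
    (hns : AcSigned.IsNonsplitIn κ v) (hγ : κ.IsTopGenerator γ) (f : IwasawaAlgebra p) (h : ∀ w : S₀, (L w).H) :
    phiLocImage S κ γ θ' P M hstabK PG hPred hM V j S₀ hS₀ ε v hres hv L S₁ hS₀S₁
        (letI : ∀ w : HeightOneSpectrum (𝓞 K), Module (IwasawaAlgebra p) (L w).H := fun w ↦ (L w).moduleIwasawa
         f • h) =
      (isLocNil_conjLocImage_sub_one κ (padicCoeffIntegers S) V j S₀ ε v hres hv S₁ hns hM hstabK hγ).smulFun f
        (phiLocImage S κ γ θ' P M hstabK PG hPred hM V j S₀ hS₀ ε v hres hv L S₁ hS₀S₁ h) := by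
  letI : ∀ w : HeightOneSpectrum (𝓞 K), Module (IwasawaAlgebra p) (L w).H := fun w ↦ (L w).moduleIwasawa
  exact (isLocNil_conjLocImage_sub_one κ (padicCoeffIntegers S) V j S₀ ε v hres hv S₁ hns hM hstabK hγ).map_smul_eq_smulFun (X' := ∀ w : S₀, (L w).H)
    (phiLocImage S κ γ θ' P M hstabK PG hPred hM V j S₀ hS₀ ε v hres hv L S₁ hS₀S₁)
    (fun h q ↦ phiLocImage_X_smul S κ γ θ' P M hstabK PG hPred hM V j S₀ hS₀ ε v hres hv L S₁ hS₀S₁ hns h q)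
    (fun c h q k hq ↦ phiLocImage_C_smul S κ γ θ' P M hstabK PG hPred hM V j S₀ hS₀ ε v hres hv L S₁ hS₀S₁ hPsc c h q k hq) f h

/-- ★★★ **`Φ` as a `Λ`-linear map** `Π_{w∈S₀} 𝐇¹_{Iw,w} →ₗ[Λ] (Sel_{str,v} ⧸ Sel_{str at Σ})^∨` — the map of T5's λ-assembly `lambdaInvariant_le_add_of_ker_subset_range_semilocMapPi` (p812244), to be
restricted to the `(S₀ ∖ P)`-unramified classes `H′`. [cite: Rubin2000, Thm. 1.7.3, App. B.3] [cite: Kobayashi2003, Thm. 7.3 i)] -/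
def phiLinearMap [SMulCommClass (absoluteGaloisGroup K) (padicCoeffIntegers S) M]
    (hPsc : ∀ (k : ℕ) (a : padicCoeffIntegers S) (x : ↥(Representation.invariants ((muTwistO S θ' k).toRepresentation.comp (ramificationSubgroup K P).subtype)))
      (m : ↥(torsionPow M p k)), (PG k).toLin (coeffMapO S P θ' (oMuScalar S (p ^ k) a) (oMuScalar_muTwistO S θ' k a) x) m = (PG k).toLin x (a • m))
    (hns : AcSigned.IsNonsplitIn κ v) (hγ : κ.IsTopGenerator γ) :
    letI : ∀ w : HeightOneSpectrum (𝓞 K), Module (IwasawaAlgebra p) (L w).H := fun w ↦ (L w).moduleIwasawa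
    letI := locImageDualModule κ (padicCoeffIntegers S) V j S₀ ε v hres hv S₁ hns hM hstabK hγ
    (∀ w : S₀, (L w).H) →ₗ[IwasawaAlgebra p] (locImageQuot κ M (padicCoeffIntegers S) V j S₀ ε v hres hv S₁ →+ AddCircle (1 : ℚ)) :=
  letI : ∀ w : HeightOneSpectrum (𝓞 K), Module (IwasawaAlgebra p) (L w).H := fun w ↦ (L w).moduleIwasawa
  letI := locImageDualModule κ (padicCoeffIntegers S) V j S₀ ε v hres hv S₁ hns hM hstabK hγ
  { toFun := phiLocImage S κ γ θ' P M hstabK PG hPred hM V j S₀ hS₀ ε v hres hv L S₁ hS₀S₁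
    map_add' := map_add _
    map_smul' := fun f h ↦ phiLocImage_smul_eq_smulFun S κ γ θ' P M hstabK PG hPred hM V j S₀ hS₀ ε v hres hv L S₁ hS₀S₁ hPsc hns hγ f h }

/-- Unfolding `phiLinearMap` (definitional). [folklore] -/
theorem phiLinearMap_apply [SMulCommClass (absoluteGaloisGroup K) (padicCoeffIntegers S) M]
    (hPsc : ∀ (k : ℕ) (a : padicCoeffIntegers S) (x : ↥(Representation.invariants ((muTwistO S θ' k).toRepresentation.comp (ramificationSubgroup K P).subtype)))
      (m : ↥(torsionPow M p k)), (PG k).toLin (coeffMapO S P θ' (oMuScalar S (p ^ k) a) (oMuScalar_muTwistO S θ' k a) x) m = (PG k).toLin x (a • m))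
    (hns : AcSigned.IsNonsplitIn κ v) (hγ : κ.IsTopGenerator γ) (h : ∀ w : S₀, (L w).H) :
    phiLinearMap S κ γ θ' P M hstabK PG hPred hM V j S₀ hS₀ ε v hres hv L S₁ hS₀S₁ hPsc hns hγ h =
      phiLocImage S κ γ θ' P M hstabK PG hPred hM V j S₀ hS₀ ε v hres hv L S₁ hS₀S₁ h :=
  rfl

/-! ## §3. Evaluation on torsion-level data -/

/-- ★ **`Φ h [res_n(torsToH1 ℓ)] = Σ_{w∈S₀} ⟨proj_{n,k} h_w, semilocDual ℓ⟩_{w,n,k} / p^k`** — the value of `Φ` on the class of a layer class lifted to `M[p^k]`-coefficients, read in the currency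
of T4's levelwise orthogonality hypothesis (N2c `pairInf_apply_resOfLe_torsToH1`). [cite: Kobayashi2003, Thm. 7.3 i)] [cite: Rubin2000, Thm. 1.7.3] -/
theorem phiLocImage_mk_eq_sum_semilocPairNKQ (h : ∀ w : S₀, (L w).H) (s : strictAt κ M (padicCoeffIntegers S) V j S₀ ε v hres hv) (n k : ℕ)
    (ℓ : subgroupH1 (κ.layerSubgroup n) ↥(torsionPow M p k))
    (hs : ((s : signedTransportSelmerInftySat κ M (padicCoeffIntegers S) V j S₀ ε) : subgroupH1 κ.kerSubgroup M) =
      resOfLe M (κ.kerSubgroup_le_layerSubgroup n) (torsToH1 M p (κ.layerSubgroup n) k ℓ)) :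
    phiLocImage S κ γ θ' P M hstabK PG hPred hM V j S₀ hS₀ ε v hres hv L S₁ hS₀S₁ h (QuotientAddGroup.mk s) =
      haveI := hS₀.fintype
      ∑ w : S₀, semilocPairNKQ S κ θ' P M hstabK PG w n k ((L w).proj n k (h w)) ℓ := by
  haveI := hS₀.fintype
  rw [phiLocImage_mk, hs]
  exact Finset.sum_congr rfl fun w _ ↦ (L w).pairInf_apply_resOfLe_torsToH1 M hstabK PG hPred hM (h w) n k ℓ

end Phi

end Summit.BirchSwinnertonDyer.BirchSwinnertonDyer.Theorems.SmallImageRttD2Seq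

end
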